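import Summits.Ventures.YMGap.Thresholds.ZeroCouplingCylinderAllGroups
import HarnessLib

/-!
# Wilson loops enclosing at least two plaquettes have NO first-order strong-coupling term — every compact gauge group,
# uniformly over all DLR states (row type C-SLOPE-0-G, part 5: the first step of the area law)

Cell `pub-ymgap`, seat ds-1 (gen 15). HONEST FRAMING: exact LATTICE statement at the strong-coupling end point `β = 0` of the Wilson
action on `ℤ^d` for an ARBITRARY compact metrisable gauge group `G`, continuous `ρ`, every `d`, both signs of `β`: the `O(β)` Taylor
coefficient of a rectangular Wilson loop vanishes unless the loop is a single plaquette, uniformly over all DLR states. This is the first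
(trivial) order of the strong-coupling area law, not an area law; nothing about weak coupling, the continuum, or Clay. 0 defs, 0 compute.

* `eq_one_of_plaquetteEdges_subset_loopEdges` (geometry of `ℤ^d`): if the four links of a plaquette all lie on the boundary of the
  `R × T` rectangle in the `(i, j)` plane (`i ≠ j`), then `R = 1` and `T = 1`.
* `cov_rectangle_plaquetteObs_zdHaar_eq_zero`: under the infinite Haar product, the loop observable `Re tr ρ(U_{R×T})` is uncorrelated
  with the plaquette observable of every plaquette having a link OFF the loop (resample that link: gen 11's `integral_comp_plaquette_mul_eq`).
* ★★ `exists_forall_abs_integral_rectangle_sub_le_sq`: for `R, T ≥ 1` with `(R, T) ≠ (1, 1)` there is `K` such that for EVERY `β` and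
  EVERY `ν ∈ 𝒢(β)`, `|∫ Re tr ρ(U_{R×T}) dν − ∫ Re tr ρ(U_{R×T}) d(dg_∞)| ≤ K β²` (part 3's first-order expansion for cylinder observables:
  the coefficient `Σ_p Cov_{dg_∞}(W, Re tr ρ(U_p))` over the plaquettes touching the loop vanishes term by term).

References: K. Wilson, PRD 10 (1974) 2445 (strong-coupling expansion of loops); K. Osterwalder, E. Seiler, Ann. Phys. 110 (1978) 440 §3.
-/

noncomputable section

open MeasureTheory ProbabilityTheory Set Filter Topology Finset
open scoped NNReal
open Literature.MathematicalPhysics.QuantumLattice (LGConfig ZdEdge ZdPlaquette ymGibbsMeasures plaquetteObs plaquetteEdges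
  plaquettesTouching plaquetteHolonomyZd wilsonBoundaryAction IsCylinder continuous_plaquetteObs isCylinder_plaquetteObs)
open Literature.MathematicalPhysics.QuantumFieldTheory hiding ZdEdge
open Literature.MathematicalPhysics.QuantumFieldTheory.PlaquetteLowerBound (reTr continuous_reTr integral_comp_plaquette_eq)
open Literature.MathematicalPhysics.QuantumFieldTheory.AreaLaw (loopEdges lineEdges mem_lineEdges_iff dependsOn_rectangle
  continuous_rectangle integrable_zdHaar_of_continuous)

namespace Summit.Ventures.YMGap.ZeroCouplingSlope

/-! ## 1. Geometry: no plaquette fits on the boundary of a rectangle of area `≥ 2` -/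

section Geometry

variable {d : ℕ}

/-- **No plaquette lies on the boundary of an `R × T` loop unless `R = T = 1`.** If `i ≠ j` and the four links of a plaquette `q`
all belong to `loopEdges x i j R T`, then `R = 1` and `T = 1` (the two `i`-links of `q` are unit `j`-translates of each other and lie on
the two `i`-sides of the rectangle, which are `T` apart; likewise for the `j`-links). [folklore] -/
theorem eq_one_of_plaquetteEdges_subset_loopEdges {x : Literature.Probability.LatticeModels.Site d} {i j : Fin d} (hij : i ≠ j)
    {R T : ℕ} {q : ZdPlaquette d} (h : plaquetteEdges q ⊆ loopEdges x i j R T) : R = 1 ∧ T = 1 := by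
  -- an edge of the loop of direction `k` lies on one of the two sides of direction `k`
  have hmem : ∀ {y : Literature.Probability.LatticeModels.Site d} {k : Fin d}, (y, k) ∈ loopEdges x i j R T →
      (k = i ∧ ((∃ t : ℕ, t < R ∧ y = x + Pi.single i (t : ℤ)) ∨
        (∃ t : ℕ, t < R ∧ y = x + Pi.single j (T : ℤ) + Pi.single i (t : ℤ)))) ∨
      (k = j ∧ ((∃ t : ℕ, t < T ∧ y = x + Pi.single i (R : ℤ) + Pi.single j (t : ℤ)) ∨
        (∃ t : ℕ, t < T ∧ y = x + Pi.single j (t : ℤ)))) := by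
    intro y k hy
    simp only [loopEdges, Finset.mem_union, mem_lineEdges_iff, Prod.mk.injEq] at hy
    rcases hy with ((⟨t, ht, hy, hk⟩ | ⟨t, ht, hy, hk⟩) | ⟨t, ht, hy, hk⟩) | ⟨t, ht, hy, hk⟩
    · exact Or.inl ⟨hk, Or.inl ⟨t, ht, hy⟩⟩
    · exact Or.inr ⟨hk, Or.inl ⟨t, ht, hy⟩⟩
    · exact Or.inl ⟨hk, Or.inr ⟨t, ht, hy⟩⟩
    · exact Or.inr ⟨hk, Or.inr ⟨t, ht, hy⟩⟩
  -- two parallel `i`-edges at `z` and `z + e_j` force `T = 1`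
  have hT : ∀ {z : Literature.Probability.LatticeModels.Site d}, (z, i) ∈ loopEdges x i j R T →
      (z + Pi.single j 1, i) ∈ loopEdges x i j R T → T = 1 := by
    intro z hz hz'
    rcases hmem hz with ⟨-, hz1⟩ | ⟨hij', -⟩
    · rcases hmem hz' with ⟨-, hz2⟩ | ⟨hij', -⟩
      · rcases hz1 with ⟨t, -, rfl⟩ | ⟨t, -, rfl⟩ <;> rcases hz2 with ⟨t', -, h2⟩ | ⟨t', -, h2⟩ <;>
          · have h3 := congr_fun h2 j
            simp [hij.symm] at h3
            try omega
      · exact absurd hij' hij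
    · exact absurd hij' hij
  -- two parallel `j`-edges at `z` and `z + e_i` force `R = 1`
  have hR : ∀ {z : Literature.Probability.LatticeModels.Site d}, (z, j) ∈ loopEdges x i j R T →
      (z + Pi.single i 1, j) ∈ loopEdges x i j R T → R = 1 := by
    intro z hz hz'
    rcases hmem hz with ⟨hij', -⟩ | ⟨-, hz1⟩
    · exact absurd hij'.symm hij
    · rcases hmem hz' with ⟨hij', -⟩ | ⟨-, hz2⟩
      · exact absurd hij'.symm hij
      · rcases hz1 with ⟨t, -, rfl⟩ | ⟨t, -, rfl⟩ <;> rcases hz2 with ⟨t', -, h2⟩ | ⟨t', -, h2⟩ <;>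
          · have h3 := congr_fun h2 i
            simp [hij] at h3
            try omega
  -- the four edges of `q = (y; k < l)`; `k, l ∈ {i, j}` distinct
  obtain ⟨y, ⟨⟨k, l⟩, hkl⟩⟩ := q
  have e1 : (y, k) ∈ loopEdges x i j R T := h (by simp [plaquetteEdges])
  have e2 : (y + Pi.single k 1, l) ∈ loopEdges x i j R T := h (by simp [plaquetteEdges])
  have e3 : (y + Pi.single l 1, k) ∈ loopEdges x i j R T := h (by simp [plaquetteEdges])
  have e4 : (y, l) ∈ loopEdges x i j R T := h (by simp [plaquetteEdges])
  have hkl' : k ≠ l := ne_of_lt hkl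
  have hk : k = i ∨ k = j := by rcases hmem e1 with ⟨h1, -⟩ | ⟨h1, -⟩ <;> simp [h1]
  have hl : l = i ∨ l = j := by rcases hmem e4 with ⟨h1, -⟩ | ⟨h1, -⟩ <;> simp [h1]
  rcases hk with rfl | rfl
  · rcases hl with rfl | rfl
    · exact absurd rfl hkl'
    · exact ⟨hR e4 e2, hT e1 e3⟩
  · rcases hl with rfl | rfl
    · exact ⟨hR e1 e3, hT e4 e2⟩
    · exact absurd rfl hkl'

end Geometry

/-! ## 2. The loop is uncorrelated, under `dg_∞`, with every plaquette having a link off the loop -/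

section Loop

variable {d N : ℕ} {G : Type*} [Group G] [TopologicalSpace G] [IsTopologicalGroup G] [CompactSpace G]
  [MeasurableSpace G] [BorelSpace G] [SecondCountableTopology G] (ρ : G →* Matrix (Fin N) (Fin N) ℂ)

omit [TopologicalSpace G] [IsTopologicalGroup G] [CompactSpace G] [MeasurableSpace G] [BorelSpace G] [SecondCountableTopology G] in
/-- The rectangular Wilson loop observable `Re tr ρ(U_{R×T})` is a cylinder observable supported on the links of the loop. [folklore] -/
theorem isCylinder_reTr_rectangle (x : Literature.Probability.LatticeModels.Site d) (i j : Fin d) (R T : ℕ) :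
    IsCylinder (fun U : LGConfig d G => reTr ρ (ZdGaugeConfig.rectangle U x i j R T)) (loopEdges x i j R T) := fun U V h => by
  have e : ZdGaugeConfig.rectangle U x i j R T = ZdGaugeConfig.rectangle V x i j R T := dependsOn_rectangle x i j R T h
  simp only [e]

omit [CompactSpace G] [MeasurableSpace G] [BorelSpace G] [SecondCountableTopology G] in
/-- Continuity of the rectangular Wilson loop observable. [folklore] -/
theorem continuous_reTr_rectangle (hρ : Continuous ρ) (x : Literature.Probability.LatticeModels.Site d) (i j : Fin d) (R T : ℕ) :
    Continuous fun U : LGConfig d G => reTr ρ (ZdGaugeConfig.rectangle U x i j R T) :=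
  (continuous_reTr ρ hρ).comp (continuous_rectangle x i j R T)

/-- **Decoupling**: under the infinite Haar product the loop observable is uncorrelated with the plaquette observable of every plaquette
`q` having a link `e` OFF the loop (resample `e`: `U_q` becomes Haar distributed independently of the loop). [folklore] -/
theorem cov_rectangle_plaquetteObs_zdHaar_eq_zero (hρ : Continuous ρ) (x : Literature.Probability.LatticeModels.Site d) (i j : Fin d)
    (R T : ℕ) {q : ZdPlaquette d} {e : ZdEdge d} (he : e ∈ plaquetteEdges q) (heL : e ∉ loopEdges x i j R T) :
    (∫ U, reTr ρ (ZdGaugeConfig.rectangle U x i j R T) * plaquetteObs ρ q.1 q.2.1.1 q.2.1.2 U ∂(zdHaar d G)) -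
      (∫ U, reTr ρ (ZdGaugeConfig.rectangle U x i j R T) ∂(zdHaar d G)) *
        ∫ U, plaquetteObs ρ q.1 q.2.1.1 q.2.1.2 U ∂(zdHaar d G) = 0 := by
  have hW := continuous_reTr_rectangle ρ hρ x i j R T
  have hWe : ∀ (U : LGConfig d G) (g : G), reTr ρ (ZdGaugeConfig.rectangle (Function.update U e g) x i j R T) =
      reTr ρ (ZdGaugeConfig.rectangle U x i j R T) := fun U g =>
    isCylinder_reTr_rectangle ρ x i j R T fun e' he' => by
      rw [Function.update_of_ne]; rintro rfl; exact heL (Finset.mem_coe.1 he')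
  have h1 := ZeroCouplingMoments.integral_comp_plaquette_mul_eq (continuous_reTr ρ hρ) q he hW hWe
  have h2 := integral_comp_plaquette_eq (d := d) (continuous_reTr ρ hρ) q.1 (ne_of_lt q.2.2)
  have e1 : ∀ U : LGConfig d G, reTr ρ (ZdGaugeConfig.rectangle U x i j R T) * plaquetteObs ρ q.1 q.2.1.1 q.2.1.2 U =
      reTr ρ (ZdGaugeConfig.plaquette U q.1 q.2.1.1 q.2.1.2) * reTr ρ (ZdGaugeConfig.rectangle U x i j R T) := fun U => mul_comm _ _
  have e2 : ∀ U : LGConfig d G, plaquetteObs ρ q.1 q.2.1.1 q.2.1.2 U = reTr ρ (ZdGaugeConfig.plaquette U q.1 q.2.1.1 q.2.1.2) :=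
    fun U => rfl
  simp_rw [e1, e2]
  rw [h1, h2]; ring

/-! ## 3. Wilson loops of area `≥ 2` have no first-order term, uniformly over all DLR states -/

variable [T2Space G]

/-- ★★ **Wilson loops enclosing at least two plaquettes have NO first-order strong-coupling term — every compact gauge group, every
DLR state.** For `i ≠ j` and `(R, T) ≠ (1, 1)` there is `K` such that for EVERY `β` and EVERY `ν ∈ 𝒢(β)`:
`|∫ Re tr ρ(U_{R×T}) dν − ∫ Re tr ρ(U_{R×T}) d(dg_∞)| ≤ K β²` (part 3's uniform first-order expansion for the loop, whose coefficient
`Σ_{p ∩ loop ≠ ∅} Cov_{dg_∞}(W, Re tr ρ(U_p))` vanishes term by term: a plaquette with all four links on the loop would force `R = T = 1`).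
(For `R = 0` or `T = 0` the loop is degenerate and the statement is trivially true as well.) [folklore] -/
theorem exists_forall_abs_integral_rectangle_sub_le_sq (hρ : Continuous ρ) (x : Literature.Probability.LatticeModels.Site d) {i j : Fin d}
    (hij : i ≠ j) {R T : ℕ} (hRT : ¬ (R = 1 ∧ T = 1)) :
    ∃ K : ℝ, ∀ (β : ℝ) (ν : Measure (LGConfig d G)), ν ∈ ymGibbsMeasures (d := d) ρ β →
      |(∫ U, reTr ρ (ZdGaugeConfig.rectangle U x i j R T) ∂ν) -
          ∫ U, reTr ρ (ZdGaugeConfig.rectangle U x i j R T) ∂(zdHaar d G)| ≤ K * β ^ 2 := by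
  classical
  obtain ⟨K, hK⟩ := exists_forall_abs_integral_sub_taylor_le ρ hρ (isCylinder_reTr_rectangle ρ x i j R T)
    (continuous_reTr_rectangle ρ hρ x i j R T)
  refine ⟨K, fun β ν hν => ?_⟩
  have hcoef : (∫ U, reTr ρ (ZdGaugeConfig.rectangle U x i j R T) * wilsonBoundaryAction ρ (loopEdges x i j R T) U ∂(zdHaar d G)) -
      (∫ U, reTr ρ (ZdGaugeConfig.rectangle U x i j R T) ∂(zdHaar d G)) *
        ∫ U, wilsonBoundaryAction ρ (loopEdges x i j R T) U ∂(zdHaar d G) = 0 := by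
    have h := cov_wilsonBoundaryAction_zdHaar_eq_sum ρ hρ (loopEdges x i j R T) (continuous_reTr_rectangle ρ hρ x i j R T)
    rw [Finset.sum_eq_zero fun q hq => ?_, neg_eq_zero] at h
    · exact h
    · by_cases hsub : plaquetteEdges q ⊆ loopEdges x i j R T
      · exact absurd (eq_one_of_plaquetteEdges_subset_loopEdges hij hsub) hRT
      · obtain ⟨e, he, heL⟩ := Finset.not_subset.1 hsub
        exact cov_rectangle_plaquetteObs_zdHaar_eq_zero ρ hρ x i j R T he heL
  have h := hK β ν hν
  rwa [hcoef, mul_zero, add_zero] at h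

end Loop

end Summit.Ventures.YMGap.ZeroCouplingSlope
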